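import Literature.MathematicalPhysics.QuantumFieldTheory.Balaban1983to89.B8CubeMemberZd
import Literature.MathematicalPhysics.QuantumFieldTheory.Balaban1983to89.Node00.CarriersB8CubeDented

/-!
# `Balaban1983to89.B8DentedCubeMemberZd` — [Balaban1985Variational] (148)–(150) p. 301 ∕ [Balaban1985RegularSpaces] Sect. F p. 98–99: THE DENTED CUBE TOWER
# `{Ω′_j}` (`□_j` for `j < k`, `□_k ∩ Ω_k` on top) AS A MEMBER OF THE N05 INDEX `B8LeafModelZd.ZdIdx d L`, WITH PRINT'S TRUNCATIONS ((1.68)) AND THE FIVE INDEX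
# LAWS PROVED — layer 0 of the (β)∕(d3) road (the twin of dag-n05-c's `B8CubeMemberZd` §1–§2 for NODE 00's dented datum `CubeB8D`)

statement-level skeleton of published theorems with citation tags; proofs where landed; nothing here is a claim about the
Yang–Mills mass gap

`[Balaban1985RegularSpaces]` ("B8" = [6], CMP **99** (1985) 75–102): p. 77 (1.3)–(1.6) («Λ_j = Ω_j^{(j)} ∖ Ω_{j+1}^{(j)} … Ω_j^{(j)} = ⋃_{l ≥ j} B^{l−j}(Λ_l)»), p. 82
(1.31), p. 88 (1.68) («taking Λ_{k−1} ∪ B(Λ_k) as Λ_{k−1}»), p. 98–99 (the cubes `□_j`, (1.131)–(1.133), «the assumptions of Theorem 4 are satisfied for the pair of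
configurations 1, U₀″»); `[Balaban1985Variational]` ("[15]", CMP **102** (1985) 277–309): p. 300 («a cube □ intersecting Ω_j but not Ω_{j+1}»), (148)–(150) p. 301
(«Ω′_j = □_j, j = 0, 1, …, k − 1»; the top member cut back to `□_k ∩ Ω_k`), (152)–(153) p. 301 («[6] Theorem 2 … applied to U_k, 1 … ū_j = 1 on Λ′_j»).  PDF held:
`paper:balaban1985-cmp99-regular-spaces-gauge-fixing`, `paper:balaban1985-cmp102-variational-background` (pp. 24–25 = journal pp. 300–301).

CITATION HEADER (lean-in-tree rule).  Cell `pub-ymgap` (YM Track A, HUMAN RULING D-0062), DAG node N05 = [B8], seat `pub-ymgap-dag-n05-e` (g31; FAN-OUT §N05 row s3b,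
Proposition-6 lane; the (β) road: this seat WORD I.41343, dag-n05-c PRICE I.41357, plan I.41648, NODE 00 datum (d1) p655171, (d2-a) p659647 ∕ p659892).  WHY THIS FILE.
Every kernel file of the N05 Proposition-6 lineage (`B8Prop6CubeMember*`, this seat's γ re-assembly `B8Prop6CubeMember*Gamma`, the concrete Theorem-4 driver
`B8Thm4Concrete.thm4Body_concrete_*`) is keyed on a MEMBER of the index `B8LeafModelZd.ZdIdx d L` — five laws `hΩ ∕ hbox ∕ hclass ∕ htower ∕ hpart` on a tower `Ω`,
truncated cells `Λs m j` and bond classes `Λb m j`; dag-n05-c's `B8CubeMemberZd.exists_member_cube` is that member for [6]'s PURE cube tower `{□_j}`.  [15] p. 300–301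
applies [6] Theorem 2 to the DENTED tower `{Ω′_j}` of (148)–(150) (NODE 00's `Node00.CubeB8D`, tower `CubeB8D.sq`, cells `CubeB8D.lamS`).  THIS FILE supplies the
dented member: (§1) the truncated cells `CubeB8D.lamST c m` (print's (1.68) truncation at level `m`: for `m < k` the dented tower's truncation IS the pure one,
`cubeLamS L c.a c.M c.ρ c.k m`; at `m = k` it is `c.lamS`) and the driver's constraint-bond class `CubeB8D.lamB c m j` (box inside `Ω′_j`, inner-or-crossing w.r.t.
`c.lamST m` — `B8CubeMemberZd.cubeLamB` with the dented tower and cells), and (§2) THE FIVE INDEX LAWS for `(Ω, Λs, Λb) := (c.sq, c.lamST, c.lamB)` with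
★ `exists_member_dented`.  With it the sequence-generic Theorem-4 driver and every `ZdIdx`-keyed supplier apply to the dented member BY NAME; the (d3) twins of the
Proposition-6 files key on this member exactly where the pure files key on `exists_member_cube`.

WHAT THIS MODULE PROVES (kernel, 0 sorry; `c : Node00.CubeB8D d L K Ω`, `1 ≤ L`).
§1 `CubeB8D.lamST c m j` — the level-`m` truncation of the dented cells: `cubeLamS … m j` for `m < k` (`lamST_of_lt`), `c.lamS j` at `m = k` (`lamST_top`); `inBox_sq_of_mem_lamS`
   ∕ `inBox_sq_of_mem_lamST` (every cell label lies in `□_j^{(j)}`); `CubeB8D.lamB c m j` — the driver's class (fine box of the bond inside `Ω′_j = c.sq j`, inner-or-crossing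
   w.r.t. `c.lamST m`), `mem_lamB_iff` (`Iff.rfl`), `lamB_of_lt` (for `j ≤ m < k` it IS `cubeLamB L c.a c.M c.ρ c.k m j`).
§2 THE FIVE LAWS: `hΩ_sq` ((1.3), = `CubeB8D.sq_succ_subset`), `hbox_lamB`, `hclass_lamB` (by construction), ★ `htower_lamS` («Bʲ(Λ′_j) ⊂ Ω′_j»: below the top by the cube
   geometry, at the top by the dent's block law — `CubeB8D.under_lamS_top_subset`), ★ `flm_mem_lamS_of_layer` ∕ `hpart_lamS` ((1.6) at level `0` for the DENTED tower: every site of `□₀` lies under a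
   dented cell — the deepest dented member containing it, `B8Ineq132.exists_layer` on `c.sq`; the three regimes `l ≤ k − 2` (pure, `B8CubeMemberZd.flm_mem_cubeLam_of_layer`),
   `l = k − 1` (a site of `□_{k−1}` off `□_k ∩ Ω_k` has its `(k−1)`-label in the ENLARGED cell `Λ′_{k−1}`), `l = k` (a site of `□_k ∩ Ω_k` has its `k`-label in `Λ′_k` by the
   block law `CubeB8D.blocks`)); packaged as ★★ **`exists_member_dented`**: `∃ i : ZdIdx d L` with `i.k = c.k`, `i.η = η`, `i.Ω = c.sq`, `i.Λs = c.lamST`, `i.Λb = c.lamB`.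
HONEST SCOPE.  Index bookkeeping only (set algebra on the dented tower); no estimate; nothing of [6]∕[15] asserted; the datum translations of `B8CubeMemberZd` §3 ((1.132)–(1.133)
for the dented member) and the Proposition-6 twins are sequel modules.  `ℤᵈ` carriers, as the whole N05 lineage.  Count-neutral; N05 ∕ N07 NOT discharged; one finite `T⁴`
programme at fixed `ε`, Bałaban as printed; nothing continuum ∕ ℝ⁴ ∕ OS ∕ mass-gap ∕ Clay.  No `sorry`, no `instance`, no `notation`; two `def`s (`lamST`, `lamB`).
Unit `pub-ymgap-dag-n05-e` (g31), 2026-08-28.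

RELATED IN THE TREE, NOT DUPLICATED (`rg` 2026-08-28T19:45Z: `ls Balaban1983to89 | grep -ci 'DentedCubeMemberZd'` = 0): `B8CubeMemberZd` (dag-n05-c; the PURE member — USED:
`cubeLamS ∕ cubeLamB ∕ flm_mem_cubeLam_of_layer ∕ block_subset_cube_succ ∕ inBox_tower_iff_under`), `Node00.CarriersB8CubeDented` (p655171; `CubeB8D ∕ sq ∕ lamS ∕ inTop` and
their readings — USED, not re-declared), `B8LeafModelZd.ZdIdx` (the index), `B8Ineq132.exists_layer` (USED).
-/

noncomputable section

namespace Literature.MathematicalPhysics.QuantumFieldTheory.Balaban1983to89.B8DentedCubeMemberZd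

open B7Prop1Explicit B7Prop2Explicit B7Prop1Local B8Ineq130
open B8Ineq132 (Under layer exists_layer)
open B8Thm2LogB (blockTop)
open B8Eq131Cubes (cube sqLo sqHi inLo inHi flm under_flm mem_cube_iff cube_anti)
open B8Eq131CubesAdmissible (cubeFam cubeFam_false_of_le smul_mem_cube_succ_iff)
open B8CubeMemberZd (cubeLam cubeLamS cubeLamB inBox_tower_iff_under flm_mem_cubeLam_of_layer block_subset_cube_succ inBox_sq_of_mem_cubeLamS)
open B8LeafModelZd (ZdIdx)
open Node00 (CubeB8D)

variable {d : ℕ}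

/-! ## §0 Plumbing -/

/-- The floor map inverts `Under`: `x ∈ Bᵐ(z) ⇒ ⌊x∕Lᵐ⌋ = z` (private plumbing, as in `B8CubeMemberZd` ∕ `Node00.CarriersB8CubeDented`). [folklore] -/
private theorem flm_eq_of_under {L : ℕ} (hL : 1 ≤ L) {m : ℕ} {z x : B7Prop1Explicit.Site d} (hx : Under L m z x) : flm L m x = z := by
  funext i
  obtain ⟨h1, h2⟩ := hx i
  have hL0 : (0 : ℤ) < (L : ℤ) := by exact_mod_cast hL
  have hpos : (0 : ℤ) < (L : ℤ) ^ m := pow_pos hL0 m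
  simp only [flm]
  have hlo : z i ≤ x i / (L : ℤ) ^ m := Int.le_ediv_of_mul_le hpos (by linarith)
  have hhi : x i / (L : ℤ) ^ m < z i + 1 := Int.ediv_lt_of_lt_mul hpos (by linarith)
  omega

/-- The `j`-label `⌊x∕Lʲ⌋` of a site of `□_j` lies in `□_j^{(j)}`. [cite: Balaban1985RegularSpaces, p.98 («□_j is a sum of the big blocks of the lattice T_{L^{−j}}»)] -/
theorem inBox_sq_flm_of_mem_cube {L : ℕ} (hL : 1 ≤ L) {a : B7Prop1Explicit.Site d} {M ρ k j : ℕ} {x : B7Prop1Explicit.Site d}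
    (hx : x ∈ cube L a M ρ k j) : InBox (sqLo L a ρ k j) (sqHi L a M ρ k j) (flm L j x) := by
  obtain ⟨z, hz, hU⟩ := (mem_cube_iff hL).1 hx
  rw [flm_eq_of_under hL hU]; exact hz

/-! ## §1 The truncated dented cells and the driver's constraint-bond class -/

section Cells

variable {L K : ℕ} {Ω : ℕ → Set (B7Prop1Explicit.Site d)}

/-- **THE LEVEL-`m` TRUNCATION OF THE DENTED CELLS** ((1.68) «taking Λ_{k−1} ∪ B(Λ_k) as Λ_{k−1}», iterated, for the sequence `{Ω′_j}`): for `m < k` the truncation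
of the dented tower at level `m` only sees `Ω′_j = □_j`, `j ≤ m`, so it IS the pure member's `cubeLamS L a M ρ k m` (`Λ_j` for `j < m`, `□_m^{(m)}` at `j = m`); at
`m = k` (no truncation) it is the dented cells `c.lamS` of p655171. [cite: Balaban1985RegularSpaces, (1.68) p.88, (1.5)–(1.6) p.77; Balaban1985Variational, (148)–(150) p.301] -/
def _root_.Literature.MathematicalPhysics.QuantumFieldTheory.Balaban1983to89.Node00.CubeB8D.lamST (c : CubeB8D d L K Ω) (m : ℕ) :
    ℕ → Set (B7Prop1Explicit.Site d) :=
  if m < c.k then cubeLamS L c.a c.M c.ρ c.k m else c.lamS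

variable (c : CubeB8D d L K Ω)

/-- Below the top the truncated dented cells are the pure member's. [cite: Balaban1985RegularSpaces, (1.68) p.88; Balaban1985Variational, (150) p.301] -/
theorem lamST_of_lt {m : ℕ} (hm : m < c.k) : c.lamST m = cubeLamS L c.a c.M c.ρ c.k m := by
  unfold CubeB8D.lamST; rw [if_pos hm]

/-- At the top (`m = k`, no truncation) the cells are the dented cells `Λ′_j`. [cite: Balaban1985Variational, (148) p.301; Balaban1985RegularSpaces, (1.131) p.99] -/
theorem lamST_top : c.lamST c.k = c.lamS := by
  unfold CubeB8D.lamST; rw [if_neg (lt_irrefl _)]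

/-- Every dented cell label of level `j` lies in `□_j^{(j)}` (`Λ′_j ⊂ (Ω′_j)^{(j)} ⊂ □_j^{(j)}`). [cite: Balaban1985Variational, (148)–(150) p.301; Balaban1985RegularSpaces, (1.5) p.77] -/
theorem inBox_sq_of_mem_lamS {j : ℕ} {z : B7Prop1Explicit.Site d} (hz : z ∈ c.lamS j) :
    InBox (sqLo L c.a c.ρ c.k j) (sqHi L c.a c.M c.ρ c.k j) z := by
  by_cases hj : j ≤ c.k
  · simp only [Node00.CubeB8D.lamS, if_pos hj, Set.mem_setOf_eq] at hz
    exact hz.1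
  · rw [c.lamS_of_gt (by omega)] at hz
    exact absurd hz (Set.notMem_empty _)

/-- Every truncated dented cell label of level `j` lies in `□_j^{(j)}`. [cite: Balaban1985RegularSpaces, (1.68) p.88, (1.5) p.77; Balaban1985Variational, (150) p.301] -/
theorem inBox_sq_of_mem_lamST {m j : ℕ} {z : B7Prop1Explicit.Site d} (hz : z ∈ c.lamST m j) :
    InBox (sqLo L c.a c.ρ c.k j) (sqHi L c.a c.M c.ρ c.k j) z := by
  by_cases hm : m < c.k
  · rw [lamST_of_lt c hm] at hz; exact inBox_sq_of_mem_cubeLamS hz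
  · have hmk : ¬ m < c.k := hm
    unfold CubeB8D.lamST at hz; rw [if_neg hmk] at hz
    exact inBox_sq_of_mem_lamS c hz

/-- **THE DRIVER'S CONSTRAINT-BOND CLASS OF THE DENTED MEMBER at truncation `m`, level `j`** — `B8CubeMemberZd.cubeLamB` with the dented tower and cells: a level-`j` bond
`⟨b₋, b₋ + e_κ⟩` whose fine box `Bʲ(b₋) ∪ Bʲ(b₋ + e_κ)` lies in `Ω′_j = c.sq j` and which is INNER (both ends in `c.lamST m j`) or CROSSING (one end in `c.lamST m j`, the block
under the other end in `c.lamST m (j−1)` — «All sites of the contours Γ_{b₋,x} belong to Λ_{j−1}» p. 82).  The maximal class the concrete Theorem-4 driver admits.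
[cite: Balaban1985RegularSpaces, (1.31) p.82, (1.37) p.82, (1.42) p.83; Balaban1985Variational, (148)–(150) p.301, (153) p.301] -/
def _root_.Literature.MathematicalPhysics.QuantumFieldTheory.Balaban1983to89.Node00.CubeB8D.lamB (c : CubeB8D d L K Ω) (m j : ℕ) :
    Set (B7Prop1Explicit.Site d × Fin d) :=
  {b | (∀ x, InBox (loK L j b.1) (bondHiK L j b.1 b.2) x → x ∈ c.sq j) ∧
    ((b.1 ∈ c.lamST m j ∧ b.1 + e b.2 ∈ c.lamST m j) ∨
      (∃ j', j = j' + 1 ∧ (∀ x, (L : ℤ) • b.1 ≤ x → x ≤ (L : ℤ) • b.1 + blockTop L → x ∈ c.lamST m j') ∧ b.1 + e b.2 ∈ c.lamST m j) ∨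
      (∃ j', j = j' + 1 ∧ b.1 ∈ c.lamST m j ∧ (∀ x, (L : ℤ) • (b.1 + e b.2) ≤ x → x ≤ (L : ℤ) • (b.1 + e b.2) + blockTop L → x ∈ c.lamST m j')))}

/-- Membership in the driver's class, unfolded (`Iff.rfl`). [cite: Balaban1985RegularSpaces, (1.31) p.82] -/
theorem mem_lamB_iff (m j : ℕ) (b : B7Prop1Explicit.Site d × Fin d) :
    b ∈ c.lamB m j ↔ (∀ x, InBox (loK L j b.1) (bondHiK L j b.1 b.2) x → x ∈ c.sq j) ∧
      ((b.1 ∈ c.lamST m j ∧ b.1 + e b.2 ∈ c.lamST m j) ∨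
        (∃ j', j = j' + 1 ∧ (∀ x, (L : ℤ) • b.1 ≤ x → x ≤ (L : ℤ) • b.1 + blockTop L → x ∈ c.lamST m j') ∧ b.1 + e b.2 ∈ c.lamST m j) ∨
        (∃ j', j = j' + 1 ∧ b.1 ∈ c.lamST m j ∧ (∀ x, (L : ℤ) • (b.1 + e b.2) ≤ x → x ≤ (L : ℤ) • (b.1 + e b.2) + blockTop L → x ∈ c.lamST m j'))) :=
  Iff.rfl

/-- **BELOW THE TOP THE DRIVER'S CLASS IS THE PURE MEMBER'S**: for `j ≤ m < k`, `c.lamB m j = cubeLamB L c.a c.M c.ρ c.k m j` (the truncation at `m < k` sees only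
`Ω′_j = □_j`). [cite: Balaban1985Variational, (150) p.301; Balaban1985RegularSpaces, (1.68) p.88, (1.31) p.82] -/
theorem lamB_of_lt {m j : ℕ} (hm : m < c.k) (hj : j ≤ m) : c.lamB m j = cubeLamB L c.a c.M c.ρ c.k m j := by
  ext b
  rw [mem_lamB_iff, lamST_of_lt c hm, c.sq_of_lt (lt_of_le_of_lt hj hm), ← cubeFam_false_of_le L c.a c.M c.ρ (le_of_lt (lt_of_le_of_lt hj hm))]
  rfl

end Cells

/-! ## §2 The five index laws and the dented member -/

section Laws

variable {L K : ℕ} {Ω : ℕ → Set (B7Prop1Explicit.Site d)} (c : CubeB8D d L K Ω)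

/-- **(1.3) for the dented tower**: `Ω′_{j+1} ⊂ Ω′_j` (p655171 `CubeB8D.sq_succ_subset`). [cite: Balaban1985RegularSpaces, (1.3) p.77; Balaban1985Variational, (150) p.301] -/
theorem hΩ_sq : ∀ j, c.sq (j + 1) ⊆ c.sq j := c.sq_succ_subset

/-- Law `hbox` of `ZdIdx` for the class `c.lamB` (by construction). [cite: Balaban1985RegularSpaces, (1.31) p.82] -/
theorem hbox_lamB :
    ∀ m, m ≤ c.k → ∀ j, j ≤ m → ∀ b ∈ c.lamB m j, ∀ x, InBox (loK L j b.1) (bondHiK L j b.1 b.2) x → x ∈ c.sq j :=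
  fun _ _ _ _ _ hb x hx => hb.1 x hx

/-- Law `hclass` of `ZdIdx` for the class `c.lamB` (by construction). [cite: Balaban1985RegularSpaces, (1.31) p.82 («All sites of the contours Γ_{b₋,x} belong to Λ_{j−1}»)] -/
theorem hclass_lamB :
    ∀ m, m ≤ c.k → ∀ j, j ≤ m → ∀ b ∈ c.lamB m j,
      (b.1 ∈ c.lamST m j ∧ b.1 + e b.2 ∈ c.lamST m j) ∨
      (∃ j', j = j' + 1 ∧ (∀ x, (L : ℤ) • b.1 ≤ x → x ≤ (L : ℤ) • b.1 + blockTop L → x ∈ c.lamST m j') ∧ b.1 + e b.2 ∈ c.lamST m j) ∨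
      (∃ j', j = j' + 1 ∧ b.1 ∈ c.lamST m j ∧
        (∀ x, (L : ℤ) • (b.1 + e b.2) ≤ x → x ≤ (L : ℤ) • (b.1 + e b.2) + blockTop L → x ∈ c.lamST m j')) :=
  fun _ _ _ _ _ hb => hb.2

/-- ★ **Law `htower` FOR THE DENTED TOWER** («Bʲ(Λ′_j) ⊂ Ω′_j»): the level-`j` block over a dented cell label lies in `Ω′_j` — below the top because the label lies in
`□_j^{(j)}` and `Ω′_j = □_j`, at the top because a level-`k` dented cell is a `k`-site of `□_k^{(k)}` whose block lies in `Ω_k` (`CubeB8D.under_lamS_top_subset`).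
[cite: Balaban1985RegularSpaces, (1.5)–(1.6) p.77, p.98; Balaban1985Variational, (148)–(150) p.301] -/
theorem htower_lamS (hL : 1 ≤ L) :
    ∀ j, j ≤ c.k → ∀ y ∈ c.lamST c.k j, ∀ x, InBox (tlo L y j) (thi L y j) x → x ∈ c.sq j := by
  intro j hj y hy x hx
  rw [lamST_top c] at hy
  have hU : Under L j y x := (inBox_tower_iff_under L j y x).1 hx
  rcases lt_or_eq_of_le hj with hlt | heq
  · rw [c.sq_of_lt hlt]
    exact (mem_cube_iff hL).2 ⟨y, inBox_sq_of_mem_lamS c hy, hU⟩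
  · subst heq
    exact c.under_lamS_top_subset hL hy hU

/-- ★ **FROM THE LAYERS OF THE DENTED TOWER TO ITS CELLS** (twin of `B8CubeMemberZd.flm_mem_cubeLam_of_layer`): a fine site `v` of `Ω′_l` not in `Ω′_{l+1}` (for `l < k`)
has its level-`l` label `⌊v∕Lˡ⌋` in the dented cell `Λ′_l` — for `l ≤ k − 2` the pure cell (`flm_mem_cubeLam_of_layer`); for `l = k − 1` (a site of `□_{k−1}` NOT in
`□_k ∩ Ω_k`: the collar `□_{k−1} ∖ □_k` or the DENT `□_k ∖ Ω_k`) the ENLARGED cell `Λ′_{k−1}`, because a label whose block were a block of `□_k ∩ Ω_k` would put `v` there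
(`block_subset_cube_succ` + the cell's `∀ Under → ∈ Ω_k`); for `l = k` (a site of `□_k ∩ Ω_k`) the cell `Λ′_k`, its block lying in `Ω_k` by the block law
(`CubeB8D.inTop_flm_of_mem`). [cite: Balaban1985RegularSpaces, (1.5)–(1.6) p.77, (1.3) p.77; Balaban1985Variational, (148)–(150) p.301] -/
theorem flm_mem_lamS_of_layer (hL : 1 ≤ L) {l : ℕ} (hlk : l ≤ c.k) {v : B7Prop1Explicit.Site d} (hv : v ∈ layer c.sq c.k l) :
    flm L l v ∈ c.lamS l := by
  have hk := c.one_le_k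
  obtain ⟨hv1, hv2⟩ := hv
  rcases Nat.lt_or_ge (l + 1) c.k with hll | hge
  · -- `l ≤ k − 2`: pure regime
    rw [c.lamS_of_succ_lt hll]
    have hv' : v ∈ layer (cubeFam false L c.a c.M c.ρ c.k) c.k l := by
      refine ⟨?_, fun hl h => hv2 hl ?_⟩
      · rw [cubeFam_false_of_le L c.a c.M c.ρ hlk, ← c.sq_of_lt (by omega)]; exact hv1
      · rw [c.sq_of_lt hll, ← cubeFam_false_of_le L c.a c.M c.ρ hll.le]; exact h
    exact (flm_mem_cubeLam_of_layer hL c.a c.M c.ρ hlk hv').1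
  · rcases lt_or_eq_of_le hlk with hlt | heq
    · -- `l = k − 1`: the site is in `□_{k−1}` but not in `□_k ∩ Ω_k`
      have hl : l = c.k - 1 := by omega
      have hxk : v ∉ c.sq c.k := by
        have := hv2 hlt; rw [show l + 1 = c.k by omega] at this; exact this
      rw [c.sq_of_lt hlt] at hv1
      subst hl
      rw [c.mem_lamS_pred_iff]
      refine ⟨inBox_sq_flm_of_mem_cube hL hv1, fun ⟨hin, hall⟩ => hxk ?_⟩
      rw [c.sq_top]
      have hsm := (smul_mem_cube_succ_iff hL c.a c.M c.ρ hlt (flm L (c.k - 1) v)).2 hin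
      have hxc : v ∈ cube L c.a c.M c.ρ c.k (c.k - 1 + 1) :=
        block_subset_cube_succ hL c.a c.M c.ρ c.k (c.k - 1) hsm (under_flm hL _ v)
      rw [show c.k - 1 + 1 = c.k by omega] at hxc
      exact ⟨hxc, hall v (under_flm hL _ v)⟩
    · -- `l = k`: the site is in `□_k ∩ Ω_k`
      subst heq
      rw [c.sq_top] at hv1
      rw [c.mem_lamS_top_iff]
      exact ⟨inBox_sq_flm_of_mem_cube hL hv1.1, c.inTop_flm_of_mem hL hv1.2⟩

/-- ★ **Law `hpart` FOR THE DENTED TOWER** ((1.6) at level `0`: `□₀ = ⋃_{j ≤ k} Bʲ(Λ′_j)`): every fine site `x` of `Ω′₀ = □₀` lies under a dented cell — the label of `x` at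
the level of the deepest dented member containing it (`B8Ineq132.exists_layer` on `c.sq`, then `flm_mem_lamS_of_layer`).
[cite: Balaban1985RegularSpaces, (1.6) p.77, (1.3) p.77; Balaban1985Variational, (148)–(150) p.301] -/
theorem hpart_lamS (hL : 1 ≤ L) :
    ∀ x, x ∈ c.sq 0 → ∃ j, j ≤ c.k ∧ ∃ y ∈ c.lamST c.k j, InBox (tlo L y j) (thi L y j) x := by
  intro x hx
  obtain ⟨l, -, hlk, hv⟩ := exists_layer (Ω := c.sq) (Nat.zero_le c.k) hx
  refine ⟨l, hlk, flm L l x, ?_, (inBox_tower_iff_under L l _ x).2 (under_flm hL l x)⟩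
  rw [lamST_top c]
  exact flm_mem_lamS_of_layer c hL hlk hv

/-- ★★ **THE DENTED CUBE TOWER `{Ω′_j}_{j=0}^{k}` OF [15] (148)–(150) IS A MEMBER OF THE N05 INDEX `B8LeafModelZd.ZdIdx d L`** with print's truncations: for `1 ≤ L`,
`η > 0` and every dented datum `c : CubeB8D d L K Ω` there is `i : ZdIdx d L` with `i.k = c.k`, `i.η = η`, `i.Ω = c.sq` (`Ω′_j`), `i.Λs = c.lamST` (the truncations of
the dented cells), `i.Λb = c.lamB` — all five index laws checked (pattern of `B8CubeMemberZd.exists_member_cube`: every field pinned by an equation).  Every `ZdIdx`-keyed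
file of the lineage (the concrete Theorem-4 driver, the Proposition-5 ∕ b9 sockets, the Proposition-6 assembly) applies to this member BY NAME.
[cite: Balaban1985Variational, (148)–(150) p.301, (152)–(153) p.301, p.300; Balaban1985RegularSpaces, (1.131) p.99, (1.3)–(1.6) p.77, (1.68) p.88] -/
theorem exists_member_dented (hL : 1 ≤ L) {η : ℝ} (hη : 0 < η) :
    ∃ i : ZdIdx d L, i.k = c.k ∧ i.η = η ∧ i.Ω = c.sq ∧ i.Λs = c.lamST ∧ i.Λb = c.lamB :=
  ⟨⟨η, hη, c.k, c.one_le_k, c.sq, hΩ_sq c, c.lamST, c.lamB, hbox_lamB c, hclass_lamB c, htower_lamS c hL, hpart_lamS c hL⟩,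
    rfl, rfl, rfl, rfl, rfl⟩

end Laws

end Literature.MathematicalPhysics.QuantumFieldTheory.Balaban1983to89.B8DentedCubeMemberZd

end
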